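import Literature.MathematicalPhysics.KineticTheory.LangevinChainKernel
import Literature.MathematicalPhysics.KineticTheory.LangevinChainFlowBounds
import Literature.Probability.Process.BrownianSupTail
import Literature.Analysis.Calculus.TaylorSegment
import HarnessLib

/-!
# The one-step generator estimate for the transition kernels of the pinned chain

Trunk T-KINETIC (Literature/MathematicalPhysics/KineticTheory). Fifth decomposition step for the
named fact `CuneoEckmannHairerReyBellet2018_pinnedChain` (provefact unit): the analytic heart of
the Dynkin identity `P_t f - f = ∫₀ᵗ P_s(Lf) ds` for the transition kernels
`OscillatorChain.transitionKernel` of the pinned chain (`LangevinChainKernel.lean`), namely the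
uniform one-step estimate

  `sup_y |E f(Φ_h(y, B)) - f(y) - h Lf(y)| = o(h)`   (`pinnedChain_generator_step`, `ε`–`h₀` form)

for every `f ∈ C²_c` — Cuneo–Eckmann–Hairer–Rey-Bellet 2018, §3 p. 7: "The solutions to (3.1) form
a Markov process whose generator `L` is given by (3.2)". In the paper this is Itô's formula; here,
the noise being additive, it is proved by a second-order Taylor expansion along the pathwise flow:

* `bathVec`, `noise_pairPath_eq` — at a fixed time the noise is the two-dimensional Gaussian vector
  `N_h = B¹_h v_L + B²_h v_R`, `v_b = (0, √(2γT_b) e_b)`; its Gaussian integrals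
  (`integral_clm_noise`: `E ℓ(N_h) = 0`; `integral_bilin_noise`: `E Q(N_h,N_h) = h(Q(v_L,v_L) + Q(v_R,v_R))`;
  `E‖N_h‖² ≤ K₂h`, `E‖N_h‖⁴ ≤ K₄h²`) from `BrownianSupTail.lean`.
* `generator_eq_fderiv_add_half` — `Lf = Df·Y + ½(D²f(v_L,v_L) + D²f(v_R,v_R))`, i.e. the
  second-order part of the generator (CEHR (3.2)) is `½ E D²f(N₁, N₁)`.
* `taylor_bookkeeping`, `crude_bookkeeping` — deterministic bookkeeping around the Taylor polynomial.
* `pinnedChain_generator_step` — on the good event `{sup_{[0,h]}|B^b| ≤ a}` (`goodEvent`,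
  probability of the complement `O(h²)`), below the far level the increment is `N_h + D` with
  `‖D‖ ≤ hY₁`, `‖D - hY(y)‖ ≤ L₁h(a + h)` (`pinnedChain_flow_local_bounds`), so Taylor
  (`taylor_two_uniform`) leaves `ε'E‖Δ‖² + O(h(a+h)) + O(h^{3/2})`; above the far level the flow does
  not meet the support (`pinnedChain_flow_far`); off the good event everything is bounded by
  `M₀, M₁‖N‖, M₂‖N‖²` and AM–GM trades `1_{bad}‖N‖ᵏ` for `‖N‖^{2k} + 1_{bad}`. The resulting
  pointwise bound `γ₀ + γ₂‖N‖² + γ₄‖N‖⁴ + γ_c 1_{bad}` integrates to `≤ εh` for `h ≤ h₀(ε)`.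

## References

* N. Cuneo, J.-P. Eckmann, M. Hairer, L. Rey-Bellet, EJP 23 (2018) no. 55 (arXiv:1712.09413), §3
  eq. (3.2) and p. 7.
* D. Revuz, M. Yor, *Continuous Martingales and Brownian Motion* (1999), Ch. VII §1 (generator of a
  diffusion from the one-step expansion). [folklore]
-/

noncomputable section

open MeasureTheory ProbabilityTheory Filter Topology Set Metric Finset
open scoped NNReal ENNReal

namespace Literature.MathematicalPhysics.KineticTheory.HeatConduction

open Literature.Probability.Process Literature.Analysis.Calculus OscillatorChain

variable {N : ℕ}

/-! ### The noise vector at a fixed time: a two-dimensional Gaussian vector in phase space -/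

/-- The momentum direction `(0, c·1_{i = k})` of phase space carrying a bath noise of amplitude
`c` at the site with index value `k`. [folklore] -/
def bathVec (N : ℕ) (k : ℕ) (c : ℝ) : PhaseSpace N := (0, fun i => if i.val = k then c else 0)

/-- `bathVec N k c = c • (0, e_⟨k⟩)` when `k < N`. [folklore] -/
theorem bathVec_eq_smul_unitP {k : ℕ} (hk : k < N) (c : ℝ) :
    bathVec N k c = c • unitP ⟨k, hk⟩ := by
  ext i
  · simp [bathVec, unitP]
  · simp only [bathVec, unitP, Prod.smul_snd, Pi.smul_apply, Pi.single_apply, smul_eq_mul,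
      mul_ite, mul_one, mul_zero, Fin.ext_iff]

/-- `‖bathVec N k c‖ ≤ |c|`. [folklore] -/
theorem norm_bathVec_le (N k : ℕ) (c : ℝ) : ‖bathVec N k c‖ ≤ |c| := by
  rw [bathVec, Prod.norm_def, norm_zero, max_le_iff]
  refine ⟨abs_nonneg c, (pi_norm_le_iff_of_nonneg (abs_nonneg c)).2 fun i => ?_⟩
  show ‖(if i.val = k then c else 0)‖ ≤ |c|
  split_ifs <;> simp

/-- **The noise of the Brownian pair at time `t` is the Gaussian vector
`(0, η_t) = B¹_t • v_L + B²_t • v_R`** with `v_L = bathVec N 0 c_L`, `v_R = bathVec N (N-1) c_R`.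
[folklore] -/
theorem noise_pairPath_eq (c_L c_R : ℝ) (ω : WienerPair) (t : ℝ≥0) :
    (((0 : Fin N → ℝ), chainNoise N c_L c_R (pairPath ω) t) : PhaseSpace N) =
      brownian t ω.1 • bathVec N 0 c_L + brownian t ω.2 • bathVec N (N - 1) c_R := by
  ext i
  · simp [bathVec]
  · simp only [chainNoise_pairPath, Real.toNNReal_coe, bathVec, Prod.snd_add, Prod.smul_snd,
      Pi.add_apply, Pi.smul_apply, smul_eq_mul, mul_ite, mul_zero]
    ring_nf
    split_ifs <;> ring

/-- `‖η_t‖ ≤ |c_L| |B¹_{t⁺}| + |c_R| |B²_{t⁺}|` for the noise of the Brownian pair at a real time.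
[folklore] -/
theorem norm_chainNoise_pairPath_le (c_L c_R : ℝ) (ω : WienerPair) (t : ℝ) :
    ‖chainNoise N c_L c_R (pairPath ω) t‖ ≤
      |c_L| * |brownian t.toNNReal ω.1| + |c_R| * |brownian t.toNNReal ω.2| := by
  refine (pi_norm_le_iff_of_nonneg (by positivity)).2 fun i => ?_
  rw [chainNoise_pairPath, Real.norm_eq_abs]
  refine (abs_add_le _ _).trans (add_le_add ?_ ?_)
  · rw [abs_mul]
    refine mul_le_mul_of_nonneg_right ?_ (abs_nonneg _)
    split_ifs <;> simp
  · rw [abs_mul]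
    refine mul_le_mul_of_nonneg_right ?_ (abs_nonneg _)
    split_ifs <;> simp

/-- The norm of the momentum embedding: `‖(0, e)‖ = ‖e‖`. [folklore] -/
theorem norm_zero_prod (e : Fin N → ℝ) : ‖(((0 : Fin N → ℝ), e) : PhaseSpace N)‖ = ‖e‖ := by
  rw [Prod.norm_def, norm_zero, max_eq_right (norm_nonneg _)]

/-! ### Integrability of the noise functionals -/

section NoiseIntegrable

variable (c_L c_R : ℝ) (h : ℝ≥0)

/-- The noise vector is a measurable function of the pair. [folklore] -/
theorem measurable_noise :
    Measurable fun ω : WienerPair =>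
      brownian h ω.1 • bathVec N 0 c_L + brownian h ω.2 • bathVec N (N - 1) c_R :=
  (((measurable_brownian h).comp measurable_fst).smul_const _).add
    (((measurable_brownian h).comp measurable_snd).smul_const _)

/-- `‖N_h‖ ≤ |B¹||c_L| + |B²||c_R|`. [folklore] -/
theorem norm_noise_le (ω : WienerPair) :
    ‖brownian h ω.1 • bathVec N 0 c_L + brownian h ω.2 • bathVec N (N - 1) c_R‖ ≤
      |brownian h ω.1| * |c_L| + |brownian h ω.2| * |c_R| := by
  refine (norm_add_le _ _).trans (add_le_add ?_ ?_)
  · rw [norm_smul, Real.norm_eq_abs]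
    exact mul_le_mul_of_nonneg_left (norm_bathVec_le _ _ _) (abs_nonneg _)
  · rw [norm_smul, Real.norm_eq_abs]
    exact mul_le_mul_of_nonneg_left (norm_bathVec_le _ _ _) (abs_nonneg _)

/-- `‖N_h‖² ≤ 2(c_L² B¹² + c_R² B²²)`. [folklore] -/
theorem norm_noise_sq_le (ω : WienerPair) :
    ‖brownian h ω.1 • bathVec N 0 c_L + brownian h ω.2 • bathVec N (N - 1) c_R‖ ^ 2 ≤
      2 * (c_L ^ 2 * brownian h ω.1 ^ 2 + c_R ^ 2 * brownian h ω.2 ^ 2) := by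
  have h1 := norm_noise_le c_L c_R h ω (N := N)
  have h0 : 0 ≤ ‖brownian h ω.1 • bathVec N 0 c_L + brownian h ω.2 • bathVec N (N - 1) c_R‖ := norm_nonneg _
  nlinarith [sq_nonneg (|brownian h ω.1| * |c_L| - |brownian h ω.2| * |c_R|), sq_abs (brownian h ω.1),
    sq_abs (brownian h ω.2), sq_abs c_L, sq_abs c_R]

/-- `‖N_h‖⁴ ≤ 8(c_L⁴ B¹⁴ + c_R⁴ B²⁴)`. [folklore] -/
theorem norm_noise_pow_four_le (ω : WienerPair) :
    ‖brownian h ω.1 • bathVec N 0 c_L + brownian h ω.2 • bathVec N (N - 1) c_R‖ ^ 4 ≤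
      8 * (c_L ^ 4 * brownian h ω.1 ^ 4 + c_R ^ 4 * brownian h ω.2 ^ 4) := by
  set a := |brownian h ω.1| * |c_L|
  set b := |brownian h ω.2| * |c_R|
  have h1 : ‖brownian h ω.1 • bathVec N 0 c_L + brownian h ω.2 • bathVec N (N - 1) c_R‖ ≤ a + b :=
    norm_noise_le c_L c_R h ω
  have h0 : 0 ≤ ‖brownian h ω.1 • bathVec N 0 c_L + brownian h ω.2 • bathVec N (N - 1) c_R‖ := norm_nonneg _
  have ha : 0 ≤ a := by positivity
  have hb : 0 ≤ b := by positivity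
  have h2 : ‖brownian h ω.1 • bathVec N 0 c_L + brownian h ω.2 • bathVec N (N - 1) c_R‖ ^ 4 ≤ (a + b) ^ 4 := by
    gcongr
  have h3 : (a + b) ^ 4 ≤ 8 * (a ^ 4 + b ^ 4) := by
    nlinarith [sq_nonneg (a - b), sq_nonneg (a + b), sq_nonneg (a ^ 2 - b ^ 2), mul_nonneg ha hb]
  have h4 : a ^ 4 = c_L ^ 4 * brownian h ω.1 ^ 4 := by
    have e : a ^ 4 = (|brownian h ω.1| ^ 2) ^ 2 * (|c_L| ^ 2) ^ 2 := by ring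
    rw [e, sq_abs, sq_abs]; ring
  have h5 : b ^ 4 = c_R ^ 4 * brownian h ω.2 ^ 4 := by
    have e : b ^ 4 = (|brownian h ω.2| ^ 2) ^ 2 * (|c_R| ^ 2) ^ 2 := by ring
    rw [e, sq_abs, sq_abs]; ring
  linarith

/-- `‖N_h‖²` is integrable. [folklore] -/
theorem integrable_norm_noise_sq :
    Integrable (fun ω : WienerPair =>
      ‖brownian h ω.1 • bathVec N 0 c_L + brownian h ω.2 • bathVec N (N - 1) c_R‖ ^ 2) wienerPair := by
  have hint : Integrable (fun ω : WienerPair => 2 * (c_L ^ 2 * brownian h ω.1 ^ 2 + c_R ^ 2 * brownian h ω.2 ^ 2))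
      wienerPair :=
    (((integrable_brownian_fst_pow h 2).const_mul _).add ((integrable_brownian_snd_pow h 2).const_mul _)).const_mul _
  refine hint.mono' ((measurable_noise c_L c_R h).norm.pow_const 2).aestronglyMeasurable
    (Eventually.of_forall fun ω => ?_)
  rw [Real.norm_eq_abs, abs_pow, abs_norm]
  exact norm_noise_sq_le c_L c_R h ω

/-- `‖N_h‖⁴` is integrable. [folklore] -/
theorem integrable_norm_noise_pow_four :
    Integrable (fun ω : WienerPair =>
      ‖brownian h ω.1 • bathVec N 0 c_L + brownian h ω.2 • bathVec N (N - 1) c_R‖ ^ 4) wienerPair := by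
  have hint : Integrable (fun ω : WienerPair => 8 * (c_L ^ 4 * brownian h ω.1 ^ 4 + c_R ^ 4 * brownian h ω.2 ^ 4))
      wienerPair :=
    (((integrable_brownian_fst_pow h 4).const_mul _).add ((integrable_brownian_snd_pow h 4).const_mul _)).const_mul _
  refine hint.mono' ((measurable_noise c_L c_R h).norm.pow_const 4).aestronglyMeasurable
    (Eventually.of_forall fun ω => ?_)
  rw [Real.norm_eq_abs, abs_pow, abs_norm]
  exact norm_noise_pow_four_le c_L c_R h ω

/-- `ω ↦ B¹_h · r` is integrable on the pair space. [folklore] -/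
theorem integrable_brownian_fst_mul_const (r : ℝ) :
    Integrable (fun ω : WienerPair => brownian h ω.1 * r) wienerPair := by
  have h1 := (integrable_brownian_fst_pow h 1).mul_const r
  simpa [pow_one] using h1

/-- `ω ↦ B²_h · r` is integrable on the pair space. [folklore] -/
theorem integrable_brownian_snd_mul_const (r : ℝ) :
    Integrable (fun ω : WienerPair => brownian h ω.2 * r) wienerPair := by
  have h1 := (integrable_brownian_snd_pow h 1).mul_const r
  simpa [pow_one] using h1

/-- A continuous linear functional of the noise vector is integrable. [folklore] -/
theorem integrable_clm_noise (ℓ : PhaseSpace N →L[ℝ] ℝ) :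
    Integrable (fun ω : WienerPair =>
      ℓ (brownian h ω.1 • bathVec N 0 c_L + brownian h ω.2 • bathVec N (N - 1) c_R)) wienerPair := by
  have h12 : Integrable (fun ω : WienerPair => brownian h ω.1 * ℓ (bathVec N 0 c_L) +
      brownian h ω.2 * ℓ (bathVec N (N - 1) c_R)) wienerPair :=
    (integrable_brownian_fst_mul_const h _).add (integrable_brownian_snd_mul_const h _)
  refine h12.congr (Eventually.of_forall fun ω => ?_)
  simp only [map_add, map_smul, smul_eq_mul]

/-- `ω ↦ B¹_h B²_h · r` is integrable (`|B¹B²| ≤ (B¹² + B²²)/2`). [folklore] -/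
theorem integrable_brownian_fst_mul_snd_mul_const (r : ℝ) :
    Integrable (fun ω : WienerPair => brownian h ω.1 * brownian h ω.2 * r) wienerPair := by
  refine Integrable.mul_const ?_ _
  have hint : Integrable (fun ω : WienerPair => (brownian h ω.1 ^ 2 + brownian h ω.2 ^ 2) / 2) wienerPair :=
    ((integrable_brownian_fst_pow h 2).add (integrable_brownian_snd_pow h 2)).div_const 2
  refine hint.mono' (((measurable_brownian h).comp measurable_fst).mul
    ((measurable_brownian h).comp measurable_snd)).aestronglyMeasurable (Eventually.of_forall fun ω => ?_)
  rw [Real.norm_eq_abs, abs_mul]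
  nlinarith [sq_nonneg (|brownian h ω.1| - |brownian h ω.2|), sq_abs (brownian h ω.1), sq_abs (brownian h ω.2)]

/-- A continuous bilinear form of the noise vector is integrable. [folklore] -/
theorem integrable_bilin_noise (Q : PhaseSpace N →L[ℝ] PhaseSpace N →L[ℝ] ℝ) :
    Integrable (fun ω : WienerPair =>
      Q (brownian h ω.1 • bathVec N 0 c_L + brownian h ω.2 • bathVec N (N - 1) c_R)
        (brownian h ω.1 • bathVec N 0 c_L + brownian h ω.2 • bathVec N (N - 1) c_R)) wienerPair := by
  have hint : Integrable (fun ω : WienerPair =>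
      ‖Q‖ * ‖brownian h ω.1 • bathVec N 0 c_L + brownian h ω.2 • bathVec N (N - 1) c_R‖ ^ 2) wienerPair :=
    (integrable_norm_noise_sq c_L c_R h (N := N)).const_mul ‖Q‖
  have hm := measurable_noise c_L c_R h (N := N)
  refine hint.mono' (Q.continuous₂.measurable.comp (hm.prodMk hm)).aestronglyMeasurable
    (Eventually.of_forall fun ω => ?_)
  rw [Real.norm_eq_abs]
  set v := brownian h ω.1 • bathVec N 0 c_L + brownian h ω.2 • bathVec N (N - 1) c_R
  calc |Q v v| = ‖Q v v‖ := (Real.norm_eq_abs _).symm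
    _ ≤ ‖Q v‖ * ‖v‖ := ContinuousLinearMap.le_opNorm _ _
    _ ≤ ‖Q‖ * ‖v‖ * ‖v‖ := mul_le_mul_of_nonneg_right (ContinuousLinearMap.le_opNorm _ _) (norm_nonneg _)
    _ = ‖Q‖ * ‖v‖ ^ 2 := by ring

end NoiseIntegrable

/-! ### Gaussian integrals of the noise vector -/

section Gaussian

variable (c_L c_R : ℝ) (h : ℝ≥0)

/-- A continuous linear functional of the noise vector integrates to zero. [folklore] -/
theorem integral_clm_noise (ℓ : PhaseSpace N →L[ℝ] ℝ) :
    ∫ ω, ℓ (brownian h ω.1 • bathVec N 0 c_L + brownian h ω.2 • bathVec N (N - 1) c_R) ∂wienerPair = 0 := by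
  have hexp : (fun ω : WienerPair => ℓ (brownian h ω.1 • bathVec N 0 c_L + brownian h ω.2 • bathVec N (N - 1) c_R)) =
      fun ω => brownian h ω.1 * ℓ (bathVec N 0 c_L) + brownian h ω.2 * ℓ (bathVec N (N - 1) c_R) := by
    funext ω; simp only [map_add, map_smul, smul_eq_mul]
  rw [hexp, integral_add (integrable_brownian_fst_mul_const h _) (integrable_brownian_snd_mul_const h _),
    integral_mul_const, integral_mul_const, integral_brownian_fst, integral_brownian_snd]
  simp

/-- **The second-order Gaussian identity**: for a continuous bilinear form `Q`,
`E[Q(N_h, N_h)] = h (Q(v_L, v_L) + Q(v_R, v_R))` (`E B² = h`, `E[B¹B²] = 0`). [folklore] -/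
theorem integral_bilin_noise (Q : PhaseSpace N →L[ℝ] PhaseSpace N →L[ℝ] ℝ) :
    ∫ ω, Q (brownian h ω.1 • bathVec N 0 c_L + brownian h ω.2 • bathVec N (N - 1) c_R)
        (brownian h ω.1 • bathVec N 0 c_L + brownian h ω.2 • bathVec N (N - 1) c_R) ∂wienerPair =
      h * (Q (bathVec N 0 c_L) (bathVec N 0 c_L) + Q (bathVec N (N - 1) c_R) (bathVec N (N - 1) c_R)) := by
  set vL := bathVec N 0 c_L
  set vR := bathVec N (N - 1) c_R
  have hexp : (fun ω : WienerPair => Q (brownian h ω.1 • vL + brownian h ω.2 • vR)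
      (brownian h ω.1 • vL + brownian h ω.2 • vR)) = fun ω =>
      brownian h ω.1 ^ 2 * Q vL vL + brownian h ω.1 * brownian h ω.2 * (Q vL vR + Q vR vL) +
        brownian h ω.2 ^ 2 * Q vR vR := by
    funext ω
    simp only [map_add, map_smul, add_apply, FunLike.coe_smul, Pi.smul_apply,
      smul_eq_mul]
    ring
  rw [hexp]
  have h1 : Integrable (fun ω : WienerPair => brownian h ω.1 ^ 2 * Q vL vL) wienerPair :=
    (integrable_brownian_fst_pow h 2).mul_const _
  have h2 : Integrable (fun ω : WienerPair => brownian h ω.1 * brownian h ω.2 * (Q vL vR + Q vR vL)) wienerPair :=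
    integrable_brownian_fst_mul_snd_mul_const h _
  have h3 : Integrable (fun ω : WienerPair => brownian h ω.2 ^ 2 * Q vR vR) wienerPair :=
    (integrable_brownian_snd_pow h 2).mul_const _
  have h12 : Integrable (fun ω : WienerPair => brownian h ω.1 ^ 2 * Q vL vL +
      brownian h ω.1 * brownian h ω.2 * (Q vL vR + Q vR vL)) wienerPair := h1.add h2
  rw [integral_add h12 h3, integral_add h1 h2, integral_mul_const, integral_mul_const,
    integral_mul_const, integral_brownian_fst_sq, integral_brownian_snd_sq,
    integral_brownian_fst_mul_brownian_snd]
  ring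

/-- `E‖N_h‖² ≤ 2(c_L² + c_R²) h`. [folklore] -/
theorem integral_norm_noise_sq_le :
    ∫ ω, ‖brownian h ω.1 • bathVec N 0 c_L + brownian h ω.2 • bathVec N (N - 1) c_R‖ ^ 2 ∂wienerPair ≤
      2 * (c_L ^ 2 + c_R ^ 2) * h := by
  have hA : Integrable (fun ω : WienerPair => c_L ^ 2 * brownian h ω.1 ^ 2) wienerPair :=
    (integrable_brownian_fst_pow h 2).const_mul _
  have hB : Integrable (fun ω : WienerPair => c_R ^ 2 * brownian h ω.2 ^ 2) wienerPair :=
    (integrable_brownian_snd_pow h 2).const_mul _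
  have hAB : Integrable (fun ω : WienerPair => c_L ^ 2 * brownian h ω.1 ^ 2 + c_R ^ 2 * brownian h ω.2 ^ 2) wienerPair :=
    hA.add hB
  have hint : Integrable (fun ω : WienerPair => 2 * (c_L ^ 2 * brownian h ω.1 ^ 2 + c_R ^ 2 * brownian h ω.2 ^ 2))
      wienerPair := hAB.const_mul _
  calc ∫ ω, ‖brownian h ω.1 • bathVec N 0 c_L + brownian h ω.2 • bathVec N (N - 1) c_R‖ ^ 2 ∂wienerPair
      ≤ ∫ ω : WienerPair, 2 * (c_L ^ 2 * brownian h ω.1 ^ 2 + c_R ^ 2 * brownian h ω.2 ^ 2) ∂wienerPair :=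
        integral_mono_of_nonneg (Eventually.of_forall fun ω => by positivity) hint
          (Eventually.of_forall (norm_noise_sq_le c_L c_R h))
    _ = 2 * (c_L ^ 2 + c_R ^ 2) * h := by
        rw [integral_const_mul, integral_add hA hB, integral_const_mul, integral_const_mul,
          integral_brownian_fst_sq, integral_brownian_snd_sq]
        ring

/-- `E‖N_h‖⁴ ≤ 24(c_L⁴ + c_R⁴) h²`. [folklore] -/
theorem integral_norm_noise_pow_four_le :
    ∫ ω, ‖brownian h ω.1 • bathVec N 0 c_L + brownian h ω.2 • bathVec N (N - 1) c_R‖ ^ 4 ∂wienerPair ≤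
      24 * (c_L ^ 4 + c_R ^ 4) * (h : ℝ) ^ 2 := by
  have hA : Integrable (fun ω : WienerPair => c_L ^ 4 * brownian h ω.1 ^ 4) wienerPair :=
    (integrable_brownian_fst_pow h 4).const_mul _
  have hB : Integrable (fun ω : WienerPair => c_R ^ 4 * brownian h ω.2 ^ 4) wienerPair :=
    (integrable_brownian_snd_pow h 4).const_mul _
  have hAB : Integrable (fun ω : WienerPair => c_L ^ 4 * brownian h ω.1 ^ 4 + c_R ^ 4 * brownian h ω.2 ^ 4) wienerPair :=
    hA.add hB
  have hint : Integrable (fun ω : WienerPair => 8 * (c_L ^ 4 * brownian h ω.1 ^ 4 + c_R ^ 4 * brownian h ω.2 ^ 4))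
      wienerPair := hAB.const_mul _
  calc ∫ ω, ‖brownian h ω.1 • bathVec N 0 c_L + brownian h ω.2 • bathVec N (N - 1) c_R‖ ^ 4 ∂wienerPair
      ≤ ∫ ω : WienerPair, 8 * (c_L ^ 4 * brownian h ω.1 ^ 4 + c_R ^ 4 * brownian h ω.2 ^ 4) ∂wienerPair :=
        integral_mono_of_nonneg (Eventually.of_forall fun ω => by positivity) hint
          (Eventually.of_forall (norm_noise_pow_four_le c_L c_R h))
    _ = 24 * (c_L ^ 4 + c_R ^ 4) * (h : ℝ) ^ 2 := by
        rw [integral_const_mul, integral_add hA hB, integral_const_mul, integral_const_mul,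
          integral_brownian_fst_pow_four, integral_brownian_snd_pow_four]
        ring

end Gaussian




/-! ### The generator as `Df·Y + ½ E[D²f(N₁, N₁)]` -/

section Generator

/-- `∑_i [i.val = k] c · g i = c · g ⟨k, _⟩` for `k < N`. [folklore] -/
theorem sum_ite_val_eq_mul {k : ℕ} (hk : k < N) (c : ℝ) (g : Fin N → ℝ) :
    ∑ i : Fin N, (if i.val = k then c else 0) * g i = c * g ⟨k, hk⟩ := by
  rw [Finset.sum_eq_single_of_mem (⟨k, hk⟩ : Fin N) (mem_univ _)]
  · simp
  · intro b _ hb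
    rw [if_neg, zero_mul]
    exact fun h => hb (Fin.ext h)

/-- **`∂²_{p_i} f = D²f[(0,e_i), (0,e_i)]`** for `f ∈ C²`. [folklore] -/
theorem partialP_partialP_eq_fderiv_fderiv {f : PhaseSpace N → ℝ} (hf : ContDiff ℝ 2 f) (i : Fin N)
    (x : PhaseSpace N) :
    partialP i (partialP i f) x = fderiv ℝ (fderiv ℝ f) x (unitP i) (unitP i) := by
  have hfd : Differentiable ℝ f := hf.differentiable (by norm_num)
  have hfd1 : Differentiable ℝ (partialP i f) :=
    (contDiff_partialP hf (m := 1) (by norm_num) i).differentiable one_ne_zero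
  have hd : Differentiable ℝ (fderiv ℝ f) := (hf.fderiv_right (m := 1) (by norm_num)).differentiable one_ne_zero
  rw [partialP_eq_fderiv hfd1, partialP_eq_fderiv hfd, unitP_eq]
  show fderiv ℝ (fun x => fderiv ℝ f x ((0, Pi.single i 1) : PhaseSpace N)) x ((0, Pi.single i 1) : PhaseSpace N) = _
  rw [fderiv_clm_apply (hd x) (differentiableAt_const _)]
  simp

variable (P : OscillatorChain)

/-- **The generator in Taylor form**: for `N ≥ 1`, `γT_L, γT_R ≥ 0` and `f ∈ C²`,
`L f(x) = Df(x)·Y(x) + ½ (D²f(x)[v_L, v_L] + D²f(x)[v_R, v_R])` with the noise vectors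
`v_b = bathVec N b √(2γT_b)`, i.e. `½ E[D²f(x)(N₁, N₁)]` for the Gaussian noise vector of unit time
(`integral_bilin_noise`). [cite: CuneoEckmannHairerReyBellet2018, eq. (3.2)] -/
theorem generator_eq_fderiv_add_half (hN : 0 < N) {T_L T_R : ℝ} (hL : 0 ≤ P.γ * T_L) (hR : 0 ≤ P.γ * T_R)
    {f : PhaseSpace N → ℝ} (hf : ContDiff ℝ 2 f) (x : PhaseSpace N) :
    P.generator N T_L T_R f x = fderiv ℝ f x (P.drift N x) +
      (1 / 2) * (fderiv ℝ (fderiv ℝ f) x (bathVec N 0 (Real.sqrt (2 * P.γ * T_L)))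
          (bathVec N 0 (Real.sqrt (2 * P.γ * T_L))) +
        fderiv ℝ (fderiv ℝ f) x (bathVec N (N - 1) (Real.sqrt (2 * P.γ * T_R)))
          (bathVec N (N - 1) (Real.sqrt (2 * P.γ * T_R)))) := by
  have hfd : Differentiable ℝ f := hf.differentiable (by norm_num)
  rw [P.generator_eq_fderiv_drift_add N T_L T_R hfd x]
  congr 1
  have hN1 : N - 1 < N := Nat.sub_lt hN one_pos
  rw [bathVec_eq_smul_unitP hN, bathVec_eq_smul_unitP hN1]
  simp only [map_smul, smul_apply, smul_eq_mul, add_mul, Finset.sum_add_distrib,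
    mul_add]
  rw [sum_ite_val_eq_mul hN, sum_ite_val_eq_mul hN1, ← partialP_partialP_eq_fderiv_fderiv hf,
    ← partialP_partialP_eq_fderiv_fderiv hf]
  have h2L : Real.sqrt (2 * P.γ * T_L) * Real.sqrt (2 * P.γ * T_L) = 2 * P.γ * T_L :=
    Real.mul_self_sqrt (by linarith)
  have h2R : Real.sqrt (2 * P.γ * T_R) * Real.sqrt (2 * P.γ * T_R) = 2 * P.γ * T_R :=
    Real.mul_self_sqrt (by linarith)
  have e1 : Real.sqrt (2 * P.γ * T_L) * (Real.sqrt (2 * P.γ * T_L) *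
      partialP ⟨0, hN⟩ (partialP ⟨0, hN⟩ f) x) = 2 * P.γ * T_L * partialP ⟨0, hN⟩ (partialP ⟨0, hN⟩ f) x := by
    rw [← mul_assoc, h2L]
  have e2 : Real.sqrt (2 * P.γ * T_R) * (Real.sqrt (2 * P.γ * T_R) *
      partialP ⟨N - 1, hN1⟩ (partialP ⟨N - 1, hN1⟩ f) x) =
      2 * P.γ * T_R * partialP ⟨N - 1, hN1⟩ (partialP ⟨N - 1, hN1⟩ f) x := by
    rw [← mul_assoc, h2R]
  rw [e1, e2]
  ring

end Generator


/-! ### Two elementary inequalities -/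

/-- `a s ≤ a λ/2 + (a/(2λ)) s²` for `a ≥ 0`, `λ > 0` (AM–GM). [folklore] -/
theorem mul_le_amgm {a s lam : ℝ} (ha : 0 ≤ a) (hlam : 0 < lam) :
    a * s ≤ a * lam / 2 + a / (2 * lam) * s ^ 2 := by
  have h1 : s ≤ lam / 2 + s ^ 2 / (2 * lam) := by
    rw [div_add_div _ _ (two_ne_zero) (by positivity), le_div_iff₀ (by positivity)]
    nlinarith [sq_nonneg (s - lam)]
  calc a * s ≤ a * (lam / 2 + s ^ 2 / (2 * lam)) := mul_le_mul_of_nonneg_left h1 ha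
    _ = a * lam / 2 + a / (2 * lam) * s ^ 2 := by ring

/-- `s ≤ (λ/2) s² + 1/(2λ)` for `λ > 0` (AM–GM). [folklore] -/
theorem le_amgm_sq (s : ℝ) {lam : ℝ} (hlam : 0 < lam) : s ≤ lam / 2 * s ^ 2 + 1 / (2 * lam) := by
  rw [div_mul_eq_mul_div, div_add_div _ _ (two_ne_zero) (by positivity), le_div_iff₀ (by positivity)]
  nlinarith [sq_nonneg (lam * s - 1)]

/-- `s² ≤ s⁴/2 + 1/2`. [folklore] -/
theorem sq_le_pow_four_half (s : ℝ) : s ^ 2 ≤ s ^ 4 / 2 + 1 / 2 := by nlinarith [sq_nonneg (s ^ 2 - 1)]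

/-! ### Taylor bookkeeping -/

section Bookkeeping

variable {E : Type*} [NormedAddCommGroup E] [NormedSpace ℝ E]

/-- **Taylor bookkeeping.** If the second-order Taylor remainder at `y` in the direction `N + D`
is at most `ε'‖N + D‖²`, then replacing the increment `N + D` by its Gaussian part `N` in the
Taylor polynomial and the drift part `D` by its first-order proxy `v` costs
`ε'(2‖N‖² + 2d_D²) + M₁ d_Y + M₂‖N‖d_D + M₂d_D²/2` (`‖D‖ ≤ d_D`, `‖D - v‖ ≤ d_Y`). [folklore] -/
theorem taylor_bookkeeping (f : E → ℝ) (y Nv D v : E) (Df : E →L[ℝ] ℝ) (Q : E →L[ℝ] E →L[ℝ] ℝ)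
    {ε' M₁ M₂ dD dY : ℝ} (hε' : 0 ≤ ε') (hM₂0 : 0 ≤ M₂)
    (hT : |f (y + (Nv + D)) - f y - Df (Nv + D) - (1 / 2) * Q (Nv + D) (Nv + D)| ≤ ε' * ‖Nv + D‖ ^ 2)
    (hM₁ : ‖Df‖ ≤ M₁) (hM₂ : ‖Q‖ ≤ M₂) (hD : ‖D‖ ≤ dD) (hDY : ‖D - v‖ ≤ dY) :
    |f (y + (Nv + D)) - f y - Df Nv - (1 / 2) * Q Nv Nv - Df v| ≤
      ε' * (2 * ‖Nv‖ ^ 2 + 2 * dD ^ 2) + M₁ * dY + M₂ * ‖Nv‖ * dD + M₂ * dD ^ 2 / 2 := by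
  have hdD : 0 ≤ dD := (norm_nonneg _).trans hD
  have hM₁0 : 0 ≤ M₁ := (norm_nonneg _).trans hM₁
  have hNn : 0 ≤ ‖Nv‖ := norm_nonneg _
  -- algebraic decomposition
  have hdec : f (y + (Nv + D)) - f y - Df Nv - (1 / 2) * Q Nv Nv - Df v =
      (f (y + (Nv + D)) - f y - Df (Nv + D) - (1 / 2) * Q (Nv + D) (Nv + D)) +
        Df (D - v) + (1 / 2) * (Q Nv D + Q D Nv + Q D D) := by
    simp only [map_add, map_sub, add_apply]
    ring
  rw [hdec]
  have hQ2 : ∀ a b : E, |Q a b| ≤ M₂ * ‖a‖ * ‖b‖ := fun a b => by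
    rw [← Real.norm_eq_abs]
    calc ‖Q a b‖ ≤ ‖Q a‖ * ‖b‖ := ContinuousLinearMap.le_opNorm _ _
      _ ≤ ‖Q‖ * ‖a‖ * ‖b‖ := mul_le_mul_of_nonneg_right (ContinuousLinearMap.le_opNorm _ _) (norm_nonneg _)
      _ ≤ M₂ * ‖a‖ * ‖b‖ := by gcongr
  have h1 : |Df (D - v)| ≤ M₁ * dY := by
    rw [← Real.norm_eq_abs]
    exact (ContinuousLinearMap.le_opNorm _ _).trans (mul_le_mul hM₁ hDY (norm_nonneg _) hM₁0)
  have h2 : |Q Nv D| ≤ M₂ * ‖Nv‖ * dD := (hQ2 _ _).trans (by gcongr)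
  have h3 : |Q D Nv| ≤ M₂ * ‖Nv‖ * dD := by
    refine (hQ2 _ _).trans ?_
    calc M₂ * ‖D‖ * ‖Nv‖ = M₂ * ‖Nv‖ * ‖D‖ := by ring
      _ ≤ M₂ * ‖Nv‖ * dD := by gcongr
  have h4 : |Q D D| ≤ M₂ * dD ^ 2 := by
    refine (hQ2 _ _).trans ?_
    calc M₂ * ‖D‖ * ‖D‖ ≤ M₂ * dD * dD := by gcongr
      _ = M₂ * dD ^ 2 := by ring
  have h5 : ε' * ‖Nv + D‖ ^ 2 ≤ ε' * (2 * ‖Nv‖ ^ 2 + 2 * dD ^ 2) := by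
    refine mul_le_mul_of_nonneg_left ?_ hε'
    have := norm_add_le Nv D
    nlinarith [norm_nonneg (Nv + D), sq_nonneg (‖Nv‖ - ‖D‖), norm_nonneg D]
  have h6 : |(1 / 2 : ℝ) * (Q Nv D + Q D Nv + Q D D)| ≤ (1 / 2) * (M₂ * ‖Nv‖ * dD + M₂ * ‖Nv‖ * dD + M₂ * dD ^ 2) := by
    rw [abs_mul, abs_of_pos (by norm_num : (0 : ℝ) < 1 / 2)]
    refine mul_le_mul_of_nonneg_left ?_ (by norm_num)
    exact (abs_add_le _ _).trans (add_le_add ((abs_add_le _ _).trans (add_le_add h2 h3)) h4)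
  calc |f (y + (Nv + D)) - f y - Df (Nv + D) - (1 / 2) * Q (Nv + D) (Nv + D) + Df (D - v) +
        (1 / 2) * (Q Nv D + Q D Nv + Q D D)|
      ≤ |f (y + (Nv + D)) - f y - Df (Nv + D) - (1 / 2) * Q (Nv + D) (Nv + D)| + |Df (D - v)| +
        |(1 / 2 : ℝ) * (Q Nv D + Q D Nv + Q D D)| := abs_add_three _ _ _
    _ ≤ ε' * (2 * ‖Nv‖ ^ 2 + 2 * dD ^ 2) + M₁ * dY +
        (1 / 2) * (M₂ * ‖Nv‖ * dD + M₂ * ‖Nv‖ * dD + M₂ * dD ^ 2) := add_le_add (add_le_add (hT.trans h5) h1) h6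
    _ = _ := by ring

/-- **Crude bookkeeping** (used off the good event): `|f(z) - f(y) - Df N - ½Q(N,N) - s| ≤
2M₀ + M₁‖N‖ + ½M₂‖N‖² + |s|`. [folklore] -/
theorem crude_bookkeeping (f : E → ℝ) (z y Nv : E) (Df : E →L[ℝ] ℝ) (Q : E →L[ℝ] E →L[ℝ] ℝ)
    {M₀ M₁ M₂ : ℝ} (s : ℝ) (hf : ∀ x, ‖f x‖ ≤ M₀) (hM₁ : ‖Df‖ ≤ M₁) (hM₂ : ‖Q‖ ≤ M₂) :
    |f z - f y - Df Nv - (1 / 2) * Q Nv Nv - s| ≤ 2 * M₀ + M₁ * ‖Nv‖ + M₂ / 2 * ‖Nv‖ ^ 2 + |s| := by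
  have hNn : 0 ≤ ‖Nv‖ := norm_nonneg _
  have h1 : |f z| ≤ M₀ := by simpa [Real.norm_eq_abs] using hf z
  have h2 : |f y| ≤ M₀ := by simpa [Real.norm_eq_abs] using hf y
  have h3 : |Df Nv| ≤ M₁ * ‖Nv‖ := by
    rw [← Real.norm_eq_abs]
    exact (ContinuousLinearMap.le_opNorm _ _).trans (mul_le_mul_of_nonneg_right hM₁ hNn)
  have h4 : |(1 / 2 : ℝ) * Q Nv Nv| ≤ M₂ / 2 * ‖Nv‖ ^ 2 := by
    rw [abs_mul, abs_of_pos (by norm_num : (0 : ℝ) < 1 / 2), ← Real.norm_eq_abs]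
    calc 1 / 2 * ‖Q Nv Nv‖ ≤ 1 / 2 * (‖Q Nv‖ * ‖Nv‖) := by gcongr; exact ContinuousLinearMap.le_opNorm _ _
      _ ≤ 1 / 2 * (‖Q‖ * ‖Nv‖ * ‖Nv‖) := by gcongr; exact ContinuousLinearMap.le_opNorm _ _
      _ ≤ 1 / 2 * (M₂ * ‖Nv‖ * ‖Nv‖) := by gcongr
      _ = M₂ / 2 * ‖Nv‖ ^ 2 := by ring
  calc |f z - f y - Df Nv - (1 / 2) * Q Nv Nv - s|
      ≤ |f z| + |f y| + |Df Nv| + |(1 / 2 : ℝ) * Q Nv Nv| + |s| := by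
        have e : f z - f y - Df Nv - (1 / 2) * Q Nv Nv - s = f z + (-f y) + (-(Df Nv)) + (-((1/2 : ℝ) * Q Nv Nv)) + (-s) := by ring
        rw [e]
        refine (abs_add_le _ _).trans (add_le_add ((abs_add_le _ _).trans (add_le_add ((abs_add_le _ _).trans
          (add_le_add ((abs_add_le _ _).trans (add_le_add le_rfl ?_)) ?_)) ?_)) ?_) <;> rw [abs_neg]
    _ ≤ M₀ + M₀ + M₁ * ‖Nv‖ + M₂ / 2 * ‖Nv‖ ^ 2 + |s| := by gcongr
    _ = _ := by ring

end Bookkeeping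

/-! ### The one-step estimate -/

section Step

variable {ω₂ lam β γ : ℝ} (hω : 0 < ω₂) (hl : 0 ≤ lam) (hβ : 0 ≤ β) (hγ : 0 ≤ γ)
include hω hl hβ hγ

set_option maxHeartbeats 1600000 in
-- one long bookkeeping proof (constants, pointwise bound, integration, budget): ~8× the default budget
/-- **The one-step generator estimate, uniform in the starting point.** For the pinned chain
(`ω₂ > 0`, `lam, β, γ ≥ 0`, `N ≥ 1`, `T_L, T_R ≥ 0`), every `f ∈ C²_c` and every `ε > 0` there is
`h₀ > 0` such that for all `0 < h ≤ h₀` and ALL `y`,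
`|E f(Φ_h(y, B)) - f(y) - h·Lf(y)| ≤ ε h`.
Proof: on the good event `{sup_{[0,h]}|B^b| ≤ a}` the flow increment is `Δ = N_h + D` with the
Gaussian noise vector `N_h` and a drift part `D = hY(y) + O(h(a + h))` (`pinnedChain_flow_local_bounds`),
so the second-order Taylor expansion (`taylor_two_uniform`) and `E[Df·N_h] = 0`,
`½E[D²f(N_h,N_h)] = h(Lf - Df·Y)(y)` (`generator_eq_fderiv_add_half`, `integral_bilin_noise`) leave
`o(h)`; far from the support the flow does not reach it (`pinnedChain_flow_far`); the bad event has
probability `O(h²)` (`measure_compl_goodEvent_le`). [cite: CuneoEckmannHairerReyBellet2018, §3 p. 7] -/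
theorem pinnedChain_generator_step {N : ℕ} (hN : 0 < N) {T_L T_R : ℝ} (hTL : 0 ≤ T_L) (hTR : 0 ≤ T_R)
    {f : PhaseSpace N → ℝ} (hf : ContDiff ℝ 2 f) (hfc : HasCompactSupport f) {ε : ℝ} (hε : 0 < ε) :
    ∃ h₀ : ℝ, 0 < h₀ ∧ ∀ h : ℝ≥0, 0 < (h : ℝ) → (h : ℝ) ≤ h₀ → ∀ y : PhaseSpace N,
      |(∫ ω, f ((pinnedChain ω₂ lam β γ).solMap N T_L T_R h y (pairPath ω)) ∂wienerPair) - f y -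
          h * (pinnedChain ω₂ lam β γ).generator N T_L T_R f y| ≤ ε * h := by
  set P := pinnedChain ω₂ lam β γ with hP
  have hPγ : P.γ = γ := rfl
  set cL := Real.sqrt (2 * γ * T_L) with hcL
  set cR := Real.sqrt (2 * γ * T_R) with hcR
  set vL : PhaseSpace N := bathVec N 0 cL with hvL
  set vR : PhaseSpace N := bathVec N (N - 1) cR with hvR
  -- constants of the test function
  have hf1 : ContDiff ℝ 1 f := hf.of_le (by norm_num)
  have hfd : Differentiable ℝ f := hf.differentiable (by norm_num)
  obtain ⟨M₀, hM₀0, hM₀⟩ := exists_forall_norm_le_of_hasCompactSupport hf.continuous hfc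
  obtain ⟨M₁, hM₁0, hM₁⟩ := exists_forall_norm_fderiv_le hf1 hfc
  obtain ⟨M₂, hM₂0, hM₂⟩ := exists_forall_norm_fderiv_fderiv_le hf hfc
  -- the support sits below an energy level `E_K`
  obtain ⟨E_K, hE_K⟩ : ∃ E_K : ℝ, ∀ x ∈ tsupport f, P.hamiltonian N x ≤ E_K := by
    obtain ⟨C, hC⟩ := hfc.isCompact.exists_bound_of_continuousOn
      (pinnedChain_continuous_hamiltonian ω₂ lam β γ N).continuousOn
    exact ⟨C, fun x hx => (le_abs_self _).trans ((Real.norm_eq_abs _).symm.le.trans (hC x hx))⟩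
  -- far level `E₁` and local constants below it
  obtain ⟨E₁, hE₁0, hfar⟩ := pinnedChain_flow_far hω hl hβ hγ N E_K
  obtain ⟨R₀, Y₁, L₁, hR₀, hY₁, hL₁, hloc⟩ := pinnedChain_flow_local_bounds hω hl hβ hγ N hE₁0
  -- above `E₁` the test function and its derivatives vanish
  have hfar0 : ∀ x : PhaseSpace N, E₁ < P.hamiltonian N x → x ∉ tsupport f := by
    intro x hx hmem
    have h1 := hfar x hx (η := fun _ => (0 : Fin N → ℝ)) continuous_const (T := 0) (M := 0)
      (fun t _ => by simp) (by norm_num) zero_le_one 0 ⟨le_rfl, le_rfl⟩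
    rw [pinnedChain_chainFlow_of_nonpos ω₂ lam β γ N x continuous_const le_rfl] at h1
    simp only [Prod.mk_zero_zero, add_zero] at h1
    exact absurd (hE_K x hmem) (not_le.2 h1)
  have hfar_f : ∀ x : PhaseSpace N, E₁ < P.hamiltonian N x → f x = 0 := fun x hx =>
    image_eq_zero_of_notMem_tsupport (hfar0 x hx)
  have hfar_Df : ∀ x : PhaseSpace N, E₁ < P.hamiltonian N x → fderiv ℝ f x = 0 := fun x hx =>
    Function.notMem_support.1 fun hmem => hfar0 x hx (support_fderiv_subset ℝ hmem)
  have hfar_Q : ∀ x : PhaseSpace N, E₁ < P.hamiltonian N x → fderiv ℝ (fderiv ℝ f) x = 0 := fun x hx =>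
    Function.notMem_support.1 fun hmem => hfar0 x hx (tsupport_fderiv_subset ℝ (support_fderiv_subset ℝ hmem))
  -- a bound `Yb` of the drift on `{H ≤ E₁}` (for the crude bound off the good event)
  obtain ⟨Yb, hYb0, hYb⟩ : ∃ Yb : ℝ, 0 ≤ Yb ∧ ∀ x : PhaseSpace N, P.hamiltonian N x ≤ E₁ → ‖P.drift N x‖ ≤ Yb := by
    obtain ⟨C, hC⟩ := (isCompact_closedBall (0 : PhaseSpace N) (pinnedChainSublevelRadius ω₂ E₁)).exists_bound_of_continuousOn
      (pinnedChain_contDiff_drift ω₂ lam β γ N (n := 0)).continuous.continuousOn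
    refine ⟨max C 0, le_max_right _ _, fun x hx => (hC x ?_).trans (le_max_left _ _)⟩
    exact mem_closedBall_zero_iff.2 (pinnedChain_norm_le_sublevelRadius hω hl hβ γ N hx)
  -- Gaussian constants
  obtain ⟨K₂, hK₂⟩ : ∃ K₂ : ℝ, K₂ = 2 * (cL ^ 2 + cR ^ 2) := ⟨_, rfl⟩
  obtain ⟨K₄, hK₄⟩ : ∃ K₄ : ℝ, K₄ = 24 * (cL ^ 4 + cR ^ 4) := ⟨_, rfl⟩
  have hK₂0 : 0 ≤ K₂ := by rw [hK₂]; positivity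
  have hK₄0 : 0 ≤ K₄ := by rw [hK₄]; positivity
  obtain ⟨c, hc⟩ : ∃ c : ℝ, c = |cL| + |cR| + 1 := ⟨_, rfl⟩
  have hc1 : |cL| + |cR| ≤ c := by rw [hc]; linarith
  have hc0 : 0 < c := by rw [hc]; have := abs_nonneg cL; have := abs_nonneg cR; linarith
  -- small parameters
  obtain ⟨ε', hε'⟩ : ∃ ε' : ℝ, ε' = ε / (10 * (2 * K₂ + 1)) := ⟨_, rfl⟩
  have hε'0 : 0 < ε' := by rw [hε']; positivity
  obtain ⟨ρ, hρ, htaylor⟩ := taylor_two_uniform hf hfc hε'0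
  obtain ⟨lam', hlam'⟩ : ∃ lam' : ℝ, lam' = ε / (10 * (M₂ * Y₁ + 1)) := ⟨_, rfl⟩
  have hlam'0 : 0 < lam' := by rw [hlam']; positivity
  obtain ⟨lam₁, hlam₁⟩ : ∃ lam₁ : ℝ, lam₁ = ε / (10 * (M₁ * K₂ + 1)) := ⟨_, rfl⟩
  have hlam₁0 : 0 < lam₁ := by rw [hlam₁]; positivity
  obtain ⟨a, ha⟩ : ∃ a : ℝ, a = min (min (1 / (2 * c)) (ρ / (2 * c))) (ε / (10 * c * (M₁ * L₁ + 1))) := ⟨_, rfl⟩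
  have ha0 : 0 < a := by rw [ha]; positivity
  have hac2 : c * a ≤ 1 / 2 := by
    have : a ≤ 1 / (2 * c) := by rw [ha]; exact (min_le_left _ _).trans (min_le_left _ _)
    rw [le_div_iff₀ (by positivity)] at this; linarith
  have hacρ : c * a ≤ ρ / 2 := by
    have : a ≤ ρ / (2 * c) := by rw [ha]; exact (min_le_left _ _).trans (min_le_right _ _)
    rw [le_div_iff₀ (by positivity)] at this; linarith
  have hacε : M₁ * L₁ * (c * a) ≤ ε / 10 := by
    have h1 : a ≤ ε / (10 * c * (M₁ * L₁ + 1)) := by rw [ha]; exact min_le_right _ _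
    rw [le_div_iff₀ (by positivity)] at h1
    have h2 : M₁ * L₁ * (c * a) ≤ (M₁ * L₁ + 1) * (c * a) :=
      mul_le_mul_of_nonneg_right (by linarith) (by positivity)
    have h3 : (M₁ * L₁ + 1) * (c * a) = a * (10 * c * (M₁ * L₁ + 1)) / 10 := by ring
    have h4 : (M₁ * L₁ + 1) * (c * a) ≤ ε / 10 := by rw [h3]; linarith
    exact h2.trans h4
  -- the `O(h²)` coefficient and `h₀`
  obtain ⟨γ₄, hγ₄⟩ : ∃ γ₄ : ℝ, γ₄ = M₂ / 4 := ⟨_, rfl⟩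
  have hγ₄0 : 0 ≤ γ₄ := by rw [hγ₄]; positivity
  obtain ⟨γc₀, hγc₀⟩ : ∃ γc₀ : ℝ, γc₀ = 2 * M₀ + M₁ * Yb + M₁ / (2 * lam₁) + M₂ / 4 := ⟨_, rfl⟩
  have hγc₀0 : 0 ≤ γc₀ := by rw [hγc₀]; positivity
  obtain ⟨D, hD⟩ : ∃ D : ℝ, D = M₁ * L₁ * Y₁ + M₂ * Y₁ ^ 2 / 2 + 2 * ε' * Y₁ ^ 2 + M₂ * Y₁ * K₂ / (2 * lam') +
    γ₄ * K₄ + γc₀ * (16 / a ^ 4) := ⟨_, rfl⟩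
  have hD0 : 0 ≤ D := by rw [hD]; positivity
  obtain ⟨h₀, hh₀⟩ : ∃ h₀ : ℝ, h₀ = min (min 1 (a ^ 2 / 2)) (min (ρ / (2 * (Y₁ + 1))) (ε / (2 * (D + 1)))) := ⟨_, rfl⟩
  have hh₀0 : 0 < h₀ := by rw [hh₀]; positivity
  refine ⟨h₀, hh₀0, fun h hhpos hh y => ?_⟩
  -- consequences of `h ≤ h₀`
  have hh0 : 0 ≤ (h : ℝ) := h.coe_nonneg
  rw [hh₀] at hh
  have hh1 : (h : ℝ) ≤ 1 := hh.trans ((min_le_left _ _).trans (min_le_left _ _))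
  have hha : (h : ℝ) ≤ a ^ 2 / 2 := hh.trans ((min_le_left _ _).trans (min_le_right _ _))
  have hhρ : (h : ℝ) * Y₁ ≤ ρ / 2 := by
    have h1 : (h : ℝ) ≤ ρ / (2 * (Y₁ + 1)) := hh.trans ((min_le_right _ _).trans (min_le_left _ _))
    rw [le_div_iff₀ (by positivity)] at h1
    have h2 : (h : ℝ) * (2 * (Y₁ + 1)) = 2 * (h * Y₁) + 2 * h := by ring
    linarith
  have hhD : (h : ℝ) * D ≤ ε / 2 := by
    have h1 : (h : ℝ) ≤ ε / (2 * (D + 1)) := hh.trans ((min_le_right _ _).trans (min_le_right _ _))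
    rw [le_div_iff₀ (by positivity)] at h1
    have h2 : (h : ℝ) * (2 * (D + 1)) = 2 * (h * D) + 2 * h := by ring
    linarith
  -- the random variables
  set η : WienerPair → ℝ → Fin N → ℝ := fun ω => chainNoise N cL cR (pairPath ω) with hη
  set Z : WienerPair → PhaseSpace N := fun ω => P.solMap N T_L T_R h y (pairPath ω) with hZ
  set Nv : WienerPair → PhaseSpace N := fun ω => brownian h ω.1 • vL + brownian h ω.2 • vR with hNv
  set Df := fderiv ℝ f y with hDf
  set Q := fderiv ℝ (fderiv ℝ f) y with hQ
  set W : WienerPair → ℝ := fun ω =>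
    f (Z ω) - f y - Df (Nv ω) - (1 / 2) * Q (Nv ω) (Nv ω) - h * Df (P.drift N y) with hW
  set G := goodEvent a h with hG
  set χ : WienerPair → ℝ := (Gᶜ).indicator 1 with hχ
  have hZ_def : ∀ ω, Z ω = P.chainFlow N y (η ω) h := fun ω => rfl
  have hNv_eq : ∀ ω, (((0 : Fin N → ℝ), η ω h) : PhaseSpace N) = Nv ω := fun ω =>
    noise_pairPath_eq cL cR ω h
  have hηc : ∀ ω, Continuous (η ω) := fun ω => continuous_chainNoise cL cR (pairPath ω)
  -- coefficients of the pointwise bound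
  obtain ⟨γ₀, hγ₀⟩ : ∃ γ₀ : ℝ, γ₀ = M₁ * L₁ * h * (c * a + h * Y₁) + M₂ * h ^ 2 * Y₁ ^ 2 / 2 + 2 * ε' * h ^ 2 * Y₁ ^ 2 +
    M₂ * h * Y₁ * lam' / 2 := ⟨_, rfl⟩
  obtain ⟨γ₂, hγ₂⟩ : ∃ γ₂ : ℝ, γ₂ = 2 * ε' + M₂ * h * Y₁ / (2 * lam') + lam₁ / 2 * M₁ := ⟨_, rfl⟩
  obtain ⟨γc, hγc⟩ : ∃ γc : ℝ, γc = 2 * M₀ + h * M₁ * Yb + M₁ / (2 * lam₁) + M₂ / 4 := ⟨_, rfl⟩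
  have hγ₀0 : 0 ≤ γ₀ := by rw [hγ₀]; positivity
  have hγ₂0 : 0 ≤ γ₂ := by rw [hγ₂]; positivity
  have hγc0 : 0 ≤ γc := by rw [hγc]; positivity
  have hγcle : γc ≤ γc₀ := by
    rw [hγc, hγc₀]
    have h1 := mul_le_of_le_one_left (mul_nonneg hM₁0 hYb0) hh1
    have h2 : (h : ℝ) * M₁ * Yb = h * (M₁ * Yb) := by ring
    linarith
  ---------------------------------------------------------------------------------------------
  -- Step 1: the pointwise bound `|W| ≤ γ₀ + γ₂‖N‖² + γ₄‖N‖⁴ + γc χ`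
  ---------------------------------------------------------------------------------------------
  -- the drift term `h Df(Y y)` is at most `h M₁ Yb` (it vanishes above `E₁`)
  have hdrift : |(h : ℝ) * Df (P.drift N y)| ≤ h * M₁ * Yb := by
    rw [abs_mul, abs_of_nonneg hh0, mul_assoc]
    refine mul_le_mul_of_nonneg_left ?_ hh0
    rcases le_or_gt (P.hamiltonian N y) E₁ with hy | hy
    · rw [← Real.norm_eq_abs]
      exact (ContinuousLinearMap.le_opNorm _ _).trans (mul_le_mul (hM₁ y) (hYb y hy) (norm_nonneg _) hM₁0)
    · rw [hDf, hfar_Df y hy]; simp; positivity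
  have hpt : ∀ ω, |W ω| ≤ γ₀ + γ₂ * ‖Nv ω‖ ^ 2 + γ₄ * ‖Nv ω‖ ^ 4 + γc * χ ω := by
    intro ω
    obtain ⟨nN, hnN⟩ : ∃ r : ℝ, r = ‖Nv ω‖ := ⟨_, rfl⟩
    have hNn : 0 ≤ nN := by rw [hnN]; exact norm_nonneg _
    rw [← hnN]
    by_cases hωG : ω ∈ G
    · -- on the good event
      have hχ0 : χ ω = 0 := by
        have : ω ∉ Gᶜ := fun h' => h' hωG
        simp [hχ, this]
      have hMη : ∀ t ∈ Icc (0 : ℝ) h, ‖η ω t‖ ≤ c * a := by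
        intro t ht
        have hB := abs_brownian_toNNReal_le_of_mem_goodEvent hωG (s := t) ht.2
        refine (norm_chainNoise_pairPath_le cL cR ω t).trans ?_
        calc |cL| * |brownian t.toNNReal ω.1| + |cR| * |brownian t.toNNReal ω.2|
            ≤ |cL| * a + |cR| * a := add_le_add (mul_le_mul_of_nonneg_left hB.1 (abs_nonneg _))
              (mul_le_mul_of_nonneg_left hB.2 (abs_nonneg _))
          _ = (|cL| + |cR|) * a := by ring
          _ ≤ c * a := mul_le_mul_of_nonneg_right hc1 ha0.le
      have hNvn : nN ≤ c * a := by
        rw [hnN, ← hNv_eq, norm_zero_prod]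
        exact hMη h ⟨hh0, le_rfl⟩
      rcases le_or_gt (P.hamiltonian N y) E₁ with hy | hy
      · -- near the support: Taylor
        obtain ⟨-, hD1, hD2⟩ := hloc y hy (hηc ω) hMη (by linarith) hh1 h ⟨hh0, le_rfl⟩
        set Dv := Z ω - y - Nv ω with hDv
        have hZsplit : Z ω = y + (Nv ω + Dv) := by rw [hDv]; abel
        have hD1' : ‖Dv‖ ≤ h * Y₁ := by
          rw [hDv, ← hNv_eq]; exact hD1
        have hD2' : ‖Dv - (h : ℝ) • P.drift N y‖ ≤ L₁ * h * (c * a + h * Y₁) := by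
          rw [hDv, ← hNv_eq]; exact hD2
        have hΔρ : ‖Nv ω + Dv‖ ≤ ρ := by
          refine (norm_add_le _ _).trans ?_
          rw [← hnN]
          linarith
        have hT := htaylor y (Nv ω + Dv) hΔρ
        have hbk := taylor_bookkeeping f y (Nv ω) Dv ((h : ℝ) • P.drift N y) Df Q hε'0.le hM₂0 hT
          (hM₁ y) (hM₂ y) hD1' hD2'
        rw [← hnN] at hbk
        have hWeq : W ω = f (y + (Nv ω + Dv)) - f y - Df (Nv ω) - (1 / 2) * Q (Nv ω) (Nv ω) -
            Df ((h : ℝ) • P.drift N y) := by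
          rw [← hZsplit, map_smul, smul_eq_mul]
        rw [hWeq]
        refine hbk.trans ?_
        -- `M₂ ‖N‖ (hY₁) ≤ M₂hY₁λ'/2 + (M₂hY₁/(2λ')) ‖N‖²`
        have ham := mul_le_amgm (a := M₂ * (h * Y₁)) (s := nN) (by positivity) hlam'0
        rw [hχ0, mul_zero, add_zero, hγ₀, hγ₂]
        have e1 : M₂ * nN * (h * Y₁) = M₂ * (h * Y₁) * nN := by ring
        have e2 : M₂ * (↑h * Y₁) * lam' / 2 = M₂ * ↑h * Y₁ * lam' / 2 := by ring
        have e3 : M₂ * (↑h * Y₁) / (2 * lam') * nN ^ 2 = M₂ * ↑h * Y₁ / (2 * lam') * nN ^ 2 := by ring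
        have e4 : ε' * (2 * nN ^ 2 + 2 * (↑h * Y₁) ^ 2) = 2 * ε' * nN ^ 2 + 2 * ε' * ↑h ^ 2 * Y₁ ^ 2 := by ring
        have e5 : M₁ * (L₁ * ↑h * (c * a + ↑h * Y₁)) = M₁ * L₁ * ↑h * (c * a + ↑h * Y₁) := by ring
        have e6 : M₂ * (↑h * Y₁) ^ 2 / 2 = M₂ * ↑h ^ 2 * Y₁ ^ 2 / 2 := by ring
        have hsq4 : 0 ≤ γ₄ * nN ^ 4 := by positivity
        have hlam₁t : 0 ≤ lam₁ / 2 * M₁ * nN ^ 2 := by positivity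
        rw [e1, e4, e5, e6]
        rw [e2, e3] at ham
        linarith
      · -- far from the support: `W ω = 0`
        have hZfar : E_K < P.hamiltonian N (Z ω) := by
          rw [hZ_def]
          exact hfar y hy (hηc ω) hMη (by linarith) hh1 h ⟨hh0, le_rfl⟩
        have hfZ : f (Z ω) = 0 :=
          image_eq_zero_of_notMem_tsupport fun hmem => absurd (hE_K _ hmem) (not_le.2 hZfar)
        have hW0 : W ω = 0 := by
          simp only [hW, hfZ, hfar_f y hy, hDf, hfar_Df y hy, hQ, hfar_Q y hy]
          simp
        rw [hW0, abs_zero]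
        positivity
    · -- off the good event: the crude bound
      have hχ1 : χ ω = 1 := by
        have : ω ∈ Gᶜ := hωG
        simp [hχ, this]
      have hcr := crude_bookkeeping f (Z ω) y (Nv ω) Df Q ((h : ℝ) * Df (P.drift N y)) hM₀ (hM₁ y) (hM₂ y)
      rw [← hnN] at hcr
      refine hcr.trans ?_
      rw [hχ1, mul_one]
      have h1 : M₁ * nN ≤ lam₁ / 2 * M₁ * nN ^ 2 + M₁ / (2 * lam₁) := by
        have := mul_le_mul_of_nonneg_left (le_amgm_sq nN hlam₁0) hM₁0
        calc M₁ * nN ≤ M₁ * (lam₁ / 2 * nN ^ 2 + 1 / (2 * lam₁)) := this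
          _ = lam₁ / 2 * M₁ * nN ^ 2 + M₁ / (2 * lam₁) := by ring
      have h2 : M₂ / 2 * nN ^ 2 ≤ M₂ / 4 * nN ^ 4 + M₂ / 4 := by
        have := mul_le_mul_of_nonneg_left (sq_le_pow_four_half nN) (by positivity : 0 ≤ M₂ / 2)
        linarith
      have h3 : 0 ≤ (2 * ε' + M₂ * h * Y₁ / (2 * lam')) * nN ^ 2 := by positivity
      rw [hγ₂, hγ₄, hγc]
      have e1 : (2 * ε' + M₂ * ↑h * Y₁ / (2 * lam') + lam₁ / 2 * M₁) * nN ^ 2 =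
          (2 * ε' + M₂ * ↑h * Y₁ / (2 * lam')) * nN ^ 2 + lam₁ / 2 * M₁ * nN ^ 2 := by ring
      rw [e1]
      linarith
  ---------------------------------------------------------------------------------------------
  -- Step 2: integrate
  ---------------------------------------------------------------------------------------------
  have hZm : Measurable Z := pinnedChain_measurable_solMap_pairPath_right hω hl hβ hγ N T_L T_R h y
  have hNvm : Measurable Nv := measurable_noise cL cR h
  have hfZ_int : Integrable (fun ω => f (Z ω)) wienerPair :=
    (integrable_const M₀).mono' (hf.continuous.measurable.comp hZm).aestronglyMeasurable
      (Eventually.of_forall fun ω => hM₀ _)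
  have hDfN_int : Integrable (fun ω => Df (Nv ω)) wienerPair := integrable_clm_noise cL cR h Df
  have hQN_int : Integrable (fun ω => Q (Nv ω) (Nv ω)) wienerPair := integrable_bilin_noise cL cR h Q
  have hW_int : Integrable W wienerPair :=
    (((hfZ_int.sub (integrable_const _)).sub hDfN_int).sub (hQN_int.const_mul _)).sub (integrable_const _)
  have hN2_int := integrable_norm_noise_sq cL cR h (N := N)
  have hN4_int := integrable_norm_noise_pow_four cL cR h (N := N)
  have hGm : MeasurableSet G := measurableSet_goodEvent a h
  have hχ_int : Integrable χ wienerPair := (integrable_const (1 : ℝ)).indicator hGm.compl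
  -- `∫ W = E f(Z) - f(y) - h Lf(y)`
  have hW_integral : ∫ ω, W ω ∂wienerPair =
      (∫ ω, f (Z ω) ∂wienerPair) - f y - h * P.generator N T_L T_R f y := by
    have e1 : ∫ ω, W ω ∂wienerPair = (∫ ω, f (Z ω) ∂wienerPair) - f y - (∫ ω, Df (Nv ω) ∂wienerPair) -
        (1 / 2) * (∫ ω, Q (Nv ω) (Nv ω) ∂wienerPair) - h * Df (P.drift N y) := by
      have i1 : Integrable (fun ω => f (Z ω) - f y) wienerPair := hfZ_int.sub (integrable_const _)
      have i2 : Integrable (fun ω => f (Z ω) - f y - Df (Nv ω)) wienerPair := i1.sub hDfN_int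
      have i3 : Integrable (fun ω => f (Z ω) - f y - Df (Nv ω) - (1 / 2) * Q (Nv ω) (Nv ω)) wienerPair :=
        i2.sub (hQN_int.const_mul _)
      simp only [hW]
      rw [integral_sub i3 (integrable_const _), integral_sub i2 (hQN_int.const_mul _), integral_sub i1 hDfN_int,
        integral_sub hfZ_int (integrable_const _), integral_const, integral_const, integral_const_mul]
      simp [probReal_univ]
    rw [e1, integral_clm_noise cL cR h Df, integral_bilin_noise cL cR h Q,
      generator_eq_fderiv_add_half P hN (by rw [hPγ]; positivity) (by rw [hPγ]; positivity) hf y, hPγ]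
    ring
  -- the bound integrates to `γ₀ + γ₂ E‖N‖² + γ₄ E‖N‖⁴ + γc P(Gᶜ)`
  have hbound_int : Integrable (fun ω => γ₀ + γ₂ * ‖Nv ω‖ ^ 2 + γ₄ * ‖Nv ω‖ ^ 4 + γc * χ ω) wienerPair :=
    (((integrable_const _).add (hN2_int.const_mul _)).add (hN4_int.const_mul _)).add (hχ_int.const_mul _)
  have hχ_integral : ∫ ω, χ ω ∂wienerPair ≤ 16 * (h : ℝ) ^ 2 / a ^ 4 := by
    rw [hχ, integral_indicator_one hGm.compl]
    have hm := measure_compl_goodEvent_le ha0.le h (by have := pow_pos ha0 2; linarith)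
    have hfin : wienerPair Gᶜ ≠ ∞ := measure_ne_top _ _
    have h2 : (wienerPair Gᶜ).toReal ≤ 2 * (2 * (h : ℝ) ^ 2 / (a ^ 2 - h) ^ 2) := by
      have := ENNReal.toReal_mono (by simp [ENNReal.mul_eq_top]) hm
      rwa [ENNReal.toReal_mul, ENNReal.toReal_ofReal (by positivity), ENNReal.toReal_ofNat] at this
    refine (show Measure.real wienerPair Gᶜ = (wienerPair Gᶜ).toReal from rfl).le.trans (h2.trans ?_)
    -- `a² - h ≥ a²/2`
    have h3 : a ^ 2 / 2 ≤ a ^ 2 - h := by linarith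
    have h4 : 0 < a ^ 2 / 2 := by positivity
    calc 2 * (2 * (h : ℝ) ^ 2 / (a ^ 2 - h) ^ 2) ≤ 2 * (2 * (h : ℝ) ^ 2 / (a ^ 2 / 2) ^ 2) := by
          gcongr
      _ = 16 * (h : ℝ) ^ 2 / a ^ 4 := by field_simp; ring
  have hmain : |∫ ω, W ω ∂wienerPair| ≤ γ₀ + γ₂ * (K₂ * h) + γ₄ * (K₄ * (h : ℝ) ^ 2) + γc * (16 * (h : ℝ) ^ 2 / a ^ 4) := by
    calc |∫ ω, W ω ∂wienerPair| ≤ ∫ ω, |W ω| ∂wienerPair := abs_integral_le_integral_abs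
      _ ≤ ∫ ω, (γ₀ + γ₂ * ‖Nv ω‖ ^ 2 + γ₄ * ‖Nv ω‖ ^ 4 + γc * χ ω) ∂wienerPair :=
          integral_mono hW_int.abs hbound_int hpt
      _ = γ₀ + γ₂ * (∫ ω, ‖Nv ω‖ ^ 2 ∂wienerPair) + γ₄ * (∫ ω, ‖Nv ω‖ ^ 4 ∂wienerPair) +
            γc * (∫ ω, χ ω ∂wienerPair) := by
          have j1 : Integrable (fun ω => γ₀ + γ₂ * ‖Nv ω‖ ^ 2) wienerPair :=
            (integrable_const _).add (hN2_int.const_mul _)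
          have j2 : Integrable (fun ω => γ₀ + γ₂ * ‖Nv ω‖ ^ 2 + γ₄ * ‖Nv ω‖ ^ 4) wienerPair :=
            j1.add (hN4_int.const_mul _)
          rw [integral_add j2 (hχ_int.const_mul _), integral_add j1 (hN4_int.const_mul _),
            integral_add (integrable_const _) (hN2_int.const_mul _), integral_const, integral_const_mul,
            integral_const_mul, integral_const_mul]
          simp [probReal_univ]
          rfl
      _ ≤ γ₀ + γ₂ * (K₂ * h) + γ₄ * (K₄ * (h : ℝ) ^ 2) + γc * (16 * (h : ℝ) ^ 2 / a ^ 4) := by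
          have i2 : ∫ ω, ‖Nv ω‖ ^ 2 ∂wienerPair ≤ K₂ * h := by
            rw [hK₂]; exact integral_norm_noise_sq_le cL cR h
          have i4 : ∫ ω, ‖Nv ω‖ ^ 4 ∂wienerPair ≤ K₄ * (h : ℝ) ^ 2 := by
            rw [hK₄]; exact integral_norm_noise_pow_four_le cL cR h
          gcongr
  ---------------------------------------------------------------------------------------------
  -- Step 3: the budget
  ---------------------------------------------------------------------------------------------
  rw [← hW_integral]
  refine hmain.trans ?_
  have e_i : M₁ * L₁ * h * (c * a) ≤ ε / 10 * h := by
    have h1 := mul_le_mul_of_nonneg_left hacε hh0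
    have e1 : M₁ * L₁ * ↑h * (c * a) = ↑h * (M₁ * L₁ * (c * a)) := by ring
    have e2 : ε / 10 * (h : ℝ) = ↑h * (ε / 10) := by ring
    rw [e1, e2]; exact h1
  have e_ii : M₂ * h * Y₁ * lam' / 2 ≤ ε / 20 * h := by
    have key : M₂ * Y₁ * lam' ≤ ε / 10 := by
      have k1 : M₂ * Y₁ * lam' * (10 * (M₂ * Y₁ + 1)) = M₂ * Y₁ * ε := by
        rw [hlam']; field_simp
      calc M₂ * Y₁ * lam' = M₂ * Y₁ * lam' * (10 * (M₂ * Y₁ + 1)) / (10 * (M₂ * Y₁ + 1)) := by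
            field_simp
        _ = M₂ * Y₁ * ε / (10 * (M₂ * Y₁ + 1)) := by rw [k1]
        _ ≤ (M₂ * Y₁ + 1) * ε / (10 * (M₂ * Y₁ + 1)) := by gcongr; linarith
        _ = ε / 10 := by field_simp
    have h1 := mul_le_mul_of_nonneg_left key (by positivity : (0 : ℝ) ≤ h / 2)
    have e1 : M₂ * ↑h * Y₁ * lam' / 2 = ↑h / 2 * (M₂ * Y₁ * lam') := by ring
    have e2 : ε / 20 * (h : ℝ) = ↑h / 2 * (ε / 10) := by ring
    rw [e1, e2]; exact h1
  have e_iii : 2 * ε' * (K₂ * h) ≤ ε / 10 * h := by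
    have key : 2 * ε' * K₂ ≤ ε / 10 := by
      have k1 : 2 * ε' * K₂ * (10 * (2 * K₂ + 1)) = 2 * K₂ * ε := by
        rw [hε']; field_simp
      calc 2 * ε' * K₂ = 2 * ε' * K₂ * (10 * (2 * K₂ + 1)) / (10 * (2 * K₂ + 1)) := by field_simp
        _ = 2 * K₂ * ε / (10 * (2 * K₂ + 1)) := by rw [k1]
        _ ≤ (2 * K₂ + 1) * ε / (10 * (2 * K₂ + 1)) := by gcongr; linarith
        _ = ε / 10 := by field_simp
    have h1 := mul_le_mul_of_nonneg_left key hh0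
    have e1 : 2 * ε' * (K₂ * (h : ℝ)) = ↑h * (2 * ε' * K₂) := by ring
    have e2 : ε / 10 * (h : ℝ) = ↑h * (ε / 10) := by ring
    rw [e1, e2]; exact h1
  have e_iv : lam₁ / 2 * M₁ * (K₂ * h) ≤ ε / 20 * h := by
    have key : lam₁ * M₁ * K₂ ≤ ε / 10 := by
      have k1 : lam₁ * M₁ * K₂ * (10 * (M₁ * K₂ + 1)) = M₁ * K₂ * ε := by
        rw [hlam₁]; field_simp
      calc lam₁ * M₁ * K₂ = lam₁ * M₁ * K₂ * (10 * (M₁ * K₂ + 1)) / (10 * (M₁ * K₂ + 1)) := by field_simp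
        _ = M₁ * K₂ * ε / (10 * (M₁ * K₂ + 1)) := by rw [k1]
        _ ≤ (M₁ * K₂ + 1) * ε / (10 * (M₁ * K₂ + 1)) := by gcongr; linarith
        _ = ε / 10 := by field_simp
    have h1 := mul_le_mul_of_nonneg_left key (by positivity : (0 : ℝ) ≤ h / 2)
    have e1 : lam₁ / 2 * M₁ * (K₂ * (h : ℝ)) = ↑h / 2 * (lam₁ * M₁ * K₂) := by ring
    have e2 : ε / 20 * (h : ℝ) = ↑h / 2 * (ε / 10) := by ring
    rw [e1, e2]; exact h1
  -- the quadratic terms are `h · (h D') ≤ h · (h D) ≤ h ε/2`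
  have e_quad : M₁ * L₁ * h * (h * Y₁) + M₂ * h ^ 2 * Y₁ ^ 2 / 2 + 2 * ε' * h ^ 2 * Y₁ ^ 2 +
      M₂ * h * Y₁ / (2 * lam') * (K₂ * h) + γ₄ * (K₄ * (h : ℝ) ^ 2) + γc * (16 * (h : ℝ) ^ 2 / a ^ 4) ≤
      h * (h * D) := by
    have hsum : M₁ * L₁ * h * (h * Y₁) + M₂ * h ^ 2 * Y₁ ^ 2 / 2 + 2 * ε' * h ^ 2 * Y₁ ^ 2 +
        M₂ * h * Y₁ / (2 * lam') * (K₂ * h) + γ₄ * (K₄ * (h : ℝ) ^ 2) + γc * (16 * (h : ℝ) ^ 2 / a ^ 4) =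
        h * (h * (M₁ * L₁ * Y₁ + M₂ * Y₁ ^ 2 / 2 + 2 * ε' * Y₁ ^ 2 + M₂ * Y₁ * K₂ / (2 * lam') +
          γ₄ * K₄ + γc * (16 / a ^ 4))) := by
      ring
    rw [hsum]
    refine mul_le_mul_of_nonneg_left (mul_le_mul_of_nonneg_left ?_ hh0) hh0
    rw [hD]
    have : γc * (16 / a ^ 4) ≤ γc₀ * (16 / a ^ 4) := mul_le_mul_of_nonneg_right hγcle (by positivity)
    linarith
  have hfinal : γ₀ + γ₂ * (K₂ * h) + γ₄ * (K₄ * (h : ℝ) ^ 2) + γc * (16 * (h : ℝ) ^ 2 / a ^ 4) ≤ ε * h := by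
    have hexp : γ₀ + γ₂ * (K₂ * h) + γ₄ * (K₄ * (h : ℝ) ^ 2) + γc * (16 * (h : ℝ) ^ 2 / a ^ 4) =
        (M₁ * L₁ * h * (c * a) + M₂ * h * Y₁ * lam' / 2 + 2 * ε' * (K₂ * h) + lam₁ / 2 * M₁ * (K₂ * h)) +
        (M₁ * L₁ * h * (h * Y₁) + M₂ * h ^ 2 * Y₁ ^ 2 / 2 + 2 * ε' * h ^ 2 * Y₁ ^ 2 +
          M₂ * h * Y₁ / (2 * lam') * (K₂ * h) + γ₄ * (K₄ * (h : ℝ) ^ 2) + γc * (16 * (h : ℝ) ^ 2 / a ^ 4)) := by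
      rw [hγ₀, hγ₂]
      ring
    rw [hexp]
    have hq : h * (h * D) ≤ h * (ε / 2) := mul_le_mul_of_nonneg_left hhD hh0
    have hεh : 0 ≤ ε * h := by positivity
    linarith [e_i, e_ii, e_iii, e_iv, e_quad, hq]
  exact hfinal

end Step

end Literature.MathematicalPhysics.KineticTheory.HeatConduction
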